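import Literature.AnabelianGeometry.SemiGraphs.QuasiTemperoidsHomEqResRel
import Literature.AnabelianGeometry.SemiGraphs.QuasiTemperoidsPiProofs
import HarnessLib

/-!
# [SemiAnbd] Thm A.4, chart route, step S1c in the chart `T₂[A₂] = B^temp(Π₂)[A₂]`

Mochizuki, *Semi-graphs of anabelioids*, Publ. RIMS **42** (2006), Appendix, Thm A.4 (author's
manuscript pp. 82–86) [cite: MochizukiSemiAnbd2006, Thm A.4 pp.82-86].  Proof-only companion of
`QuasiTemperoidsHomEqResRel.lean`: the generic relative comparison isomorphism
(`BTemp.exists_natIso_res_of_torsorData`, any object property `P` of `B^temp(Π₂)`) specialised to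
the chart `T₂[A₂] = Over' A₂ = (admitsHomTo A₂).FullSubcategory` of the cell's Thm A.4 engine
(abc-iut row C-S1a/S1b/S1c; shapes of `HOME/staging/L3/w5-d106/S1a-SHAPES.md`): for
`F : T₂[A₂] ⥤ T₁[A₁]` preserving countable colimits, the step-S1b data and the step-S1a torsor
facts give `F ⋙ λ₁ ≅ λ₂ ⋙ B^temp(f)`, the 1-commutative square of Thm. A.4 in the chart.  The
Galois objects of `T₂[A₂]` are written `⟨Π₂/N_k, o_{a₂}⟩` (definitionally the engine's
`ThmA4Chart.Q hG₂ A₂ a₂ (N k) (hN k)`), their arrows as `ObjectProperty.homMk` of the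
`B^temp(Π₂)`-arrows (definitionally `ThmA4Chart.rightMul/proj/orbitMap`).  No definition, no named
fact; Galois-countable case only (L3-lead ν3-1); nothing here bears on anything disputed.
-/

namespace Literature.AnabelianGeometry.SemiGraphs

namespace ThmA4Chart

open CategoryTheory CategoryTheory.Limits Topology Filter

universe u

variable {G₁ : Type u} [Group G₁] [TopologicalSpace G₁] [IsTopologicalGroup G₁]
  {G₂ : Type u} [Group G₂] [TopologicalSpace G₂] [IsTopologicalGroup G₂] (hG₂ : IsTempered G₂)
  {A₁ : BTemp G₁} {A₂ : BTemp G₂} (a₂ : A₂.obj.V) (F : Over' A₂ ⥤ Over' A₁)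
  (hcolim : ∀ (J : Type) [SmallCategory J] [CountableCategory J], PreservesColimitsOfShape J F)

include hcolim in
/-- **Step S1c of the chart route for [SemiAnbd] Thm. A.4 (Galois-countable case)**: for a
functor `F : T₂[A₂] ⥤ T₁[A₁]` preserving countable colimits, the data of step S1b (a continuous
`f : Π₁ → Π₂`, a cofinal antitone sequence `N_k ≤ Stab(a₂)` of open normal subgroups, compatible
base points `y_k ∈ F(Π₂/N_k)` with `a · y_k = F(r_{f a}) y_k`) and the torsor facts of step S1a
(`fibreQ_transitive`, `fibreQ_coe_eq_of_rightMul_eq`, `map_orbitMap` — the latter with its `↔`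
fibre clause — quoted as hypotheses in their final shapes, the Galois objects `Π₂/N_k → A₂` of `T₂[A₂]` being `⟨Π₂/N_k, o_{a₂}⟩`) give a natural
isomorphism `F ⋙ λ₁ ≅ λ₂ ⋙ B^temp(f)` (`λ_i : T_i[A_i] ⥤ B^temp(Π_i)` the inclusions) — the
1-commutative square of Thm. A.4 in the chart. [cite: MochizukiSemiAnbd2006, Thm A.4 pp.82-86] -/
theorem exists_natIso_res_of_torsorData (φ : G₁ →ₜ* G₂) (N : ℕ → OpenNormalSubgroup G₂)
    (hN : ∀ k, (N k).toSubgroup ≤ BTemp.stab A₂ a₂)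
    (y : ∀ k, (F.obj ⟨BTemp.Q hG₂ (N k), ⟨BTemp.orbitMap hG₂ A₂ a₂ (N k) (hN k)⟩⟩).obj.obj.V)
    (hNanti : Antitone N) (hNbasis : ∀ U ∈ 𝓝 (1 : G₂), ∃ k, (N k : Set G₂) ⊆ U)
    (hycompat : ∀ j k, j ≤ k → ∀ h : N k ≤ N j,
      (F.map (ObjectProperty.homMk (BTemp.proj hG₂ h) :
        (⟨BTemp.Q hG₂ (N k), ⟨BTemp.orbitMap hG₂ A₂ a₂ (N k) (hN k)⟩⟩ : Over' A₂) ⟶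
          ⟨BTemp.Q hG₂ (N j), ⟨BTemp.orbitMap hG₂ A₂ a₂ (N j) (hN j)⟩⟩)).hom.hom.hom (y k) = y j)
    (hφ : ∀ (k : ℕ) (a : G₁),
      (F.obj ⟨BTemp.Q hG₂ (N k), ⟨BTemp.orbitMap hG₂ A₂ a₂ (N k) (hN k)⟩⟩).obj.obj.ρ a (y k) =
      (F.map (ObjectProperty.homMk (BTemp.rightMul hG₂ (N k) (φ a)))).hom.hom.hom (y k))
    (htransY : ∀ (k : ℕ)
      (y₁ y₂ : (F.obj ⟨BTemp.Q hG₂ (N k), ⟨BTemp.orbitMap hG₂ A₂ a₂ (N k) (hN k)⟩⟩).obj.obj.V),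
      ∃ g : G₂, (F.map (ObjectProperty.homMk (BTemp.rightMul hG₂ (N k) g))).hom.hom.hom y₁ = y₂)
    (hfree : ∀ (k : ℕ) (g g' : G₂)
      (y₁ : (F.obj ⟨BTemp.Q hG₂ (N k), ⟨BTemp.orbitMap hG₂ A₂ a₂ (N k) (hN k)⟩⟩).obj.obj.V),
      (F.map (ObjectProperty.homMk (BTemp.rightMul hG₂ (N k) g) :
          (⟨BTemp.Q hG₂ (N k), ⟨BTemp.orbitMap hG₂ A₂ a₂ (N k) (hN k)⟩⟩ : Over' A₂) ⟶
            ⟨BTemp.Q hG₂ (N k), ⟨BTemp.orbitMap hG₂ A₂ a₂ (N k) (hN k)⟩⟩)).hom.hom.hom y₁ =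
        (F.map (ObjectProperty.homMk (BTemp.rightMul hG₂ (N k) g'))).hom.hom.hom y₁ →
      (g : G₂ ⧸ (N k).toSubgroup) = g')
    (hmo : ∀ (k : ℕ) (X : Over' A₂) (x₀ : X.obj.obj.V),
      (∀ x : X.obj.obj.V, ∃ g : G₂, X.obj.obj.ρ g x₀ = x) →
      ∀ hk₀ : (N k).toSubgroup ≤ BTemp.stab X.obj x₀,
      (∀ z : (F.obj X).obj.obj.V,
        ∃ y' : (F.obj ⟨BTemp.Q hG₂ (N k), ⟨BTemp.orbitMap hG₂ A₂ a₂ (N k) (hN k)⟩⟩).obj.obj.V,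
        (F.map (ObjectProperty.homMk (BTemp.orbitMap hG₂ X.obj x₀ (N k) hk₀))).hom.hom.hom y' = z) ∧
      ∀ y₁ y₂ : (F.obj ⟨BTemp.Q hG₂ (N k), ⟨BTemp.orbitMap hG₂ A₂ a₂ (N k) (hN k)⟩⟩).obj.obj.V,
        (F.map (ObjectProperty.homMk (BTemp.orbitMap hG₂ X.obj x₀ (N k) hk₀))).hom.hom.hom y₁ =
          (F.map (ObjectProperty.homMk (BTemp.orbitMap hG₂ X.obj x₀ (N k) hk₀))).hom.hom.hom y₂ ↔
        ∃ h ∈ BTemp.stab X.obj x₀,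
          (F.map (ObjectProperty.homMk (BTemp.rightMul hG₂ (N k) h))).hom.hom.hom y₁ = y₂) :
    Nonempty (F ⋙ (admitsHomTo A₁).ι ≅ (admitsHomTo A₂).ι ⋙ BTemp.res φ) := by
  -- `T₁[A₁] ⊆ B^temp(Π₁)` is closed under countable coproducts, so `F ⋙ λ₁` preserves them
  have hcoprod : ∀ (ι : Type) [Countable ι],
      PreservesColimitsOfShape (Discrete ι) (F ⋙ (admitsHomTo A₁).ι) := by
    intro ι _
    haveI : PreservesColimitsOfShape (Discrete ι) F := hcolim _
    haveI := BTemp.isClosedUnderColimitsOfShape_discrete (G := G₁) ι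
    haveI : HasColimitsOfShape (Discrete ι) (BTemp G₁) :=
      hasColimitsOfShape_of_closedUnderColimits _ _
    haveI := admitsHomTo_isClosedUnderColimitsOfShape_discrete A₁ ι
    infer_instance
  obtain ⟨e⟩ := BTemp.exists_natIso_res_of_torsorData hG₂ (admitsHomTo A₂) (F ⋙ (admitsHomTo A₁).ι)
    (fun f ⟨g⟩ => ⟨f ≫ g⟩) hcoprod φ N (fun k => ⟨BTemp.orbitMap hG₂ A₂ a₂ (N k) (hN k)⟩) y hNanti
    hNbasis hycompat hφ htransY hfree
    (fun k X x₀ htr hk₀ => ⟨(hmo k X x₀ htr hk₀).1, fun y₁ y₂ h => ((hmo k X x₀ htr hk₀).2 y₁ y₂).mp h⟩)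
  exact ⟨e.symm⟩

end ThmA4Chart

end Literature.AnabelianGeometry.SemiGraphs
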